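import Mathlib
import Summits.Ventures.PercRepro2.Defs
import Summits.Ventures.PercRepro2.Graph
import Summits.Ventures.PercRepro2.HullDefs
import Summits.Ventures.PercRepro2.LocRows
import Summits.Ventures.PercRepro2.SwRow
import Summits.Ventures.PercRepro2.SwGlue2
import Summits.Ventures.PercRepro2.SwPath

/-!
# Row (SW) on cycles (blind cell PercRepro2, night-4 g5, 2026-08-24; proofs/NIGHT4-BRIDGE.md)

The path theorem `Path2.sw_path` (SwPath.lean) and the bridge lemma `Glue2.sw_glue2` (SwGlue2.lean)
give row (SW) on every gluing of a path `p 0 – ⋯ – p k` (`l = p 0`, `h = p k`, `o = p j` interior) with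
an arbitrary second side at `{l, h}` — in particular on every cycle `C_n` (two paths glued at `l` and
`h`), for every placement of `l`, `h`, `o` with `l`, `h` non-adjacent (adjacent `l`, `h` give `Q = ∅`).
-/

namespace Summit.Ventures.PercRepro2

namespace Path2

open Hull LocRows

open scoped Classical

variable {V : Type*} {k : ℕ} {p : Fin (k + 1) → V}

/-- **Row (SW) on every gluing of a path with an arbitrary second side at its two ends** — in
particular on every cycle (two paths glued at `l` and `h`). -/
theorem sw_path_glue2 {E₂ : Type*} [Fintype E₂] [DecidableEq E₂] {ends₂ : E₂ → Sym2 V} {V₁ V₂ : Set V}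
    (hp : Function.Injective p) {j : Fin (k + 1)} (hj : 0 < (j : ℕ)) (hjk : (j : ℕ) < k)
    (hg : Glue2.IsGluing2 (pathEnds p) ends₂ (p 0) (p (Fin.last k)) V₁ V₂) (hV₁ : ∀ v, p v ∈ V₁) :
    Sw (Glue2.glue2 (pathEnds p) ends₂) (p 0) (p (Fin.last k)) (p j) := by
  refine Glue2.sw_glue2 hg (hV₁ j) ?_ ?_ (sw_path p hp hj)
  · intro h; have := congrArg Fin.val (hp h); simp only [Fin.val_zero] at this; omega
  · intro h; have := congrArg Fin.val (hp h); simp only [Fin.val_last] at this; omega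

end Path2

end Summit.Ventures.PercRepro2
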